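import Mathlib
import HarnessLib
import Summits.HubbardSuperconductivity.HubbardSuperconductivity.Theorems.KLProgrammeKLRegimeEngineV8E5WitnessStep
import Summits.HubbardSuperconductivity.HubbardSuperconductivity.Theorems.KLProgrammeKLRegimeEngineV8E5SoftLineSharp
import Summits.HubbardSuperconductivity.HubbardSuperconductivity.Theorems.KLProgrammeKLRegimeEngineV8DefsU10
import Summits.HubbardSuperconductivity.HubbardSuperconductivity.Theorems.KLProgrammeKLRegimeEngineV8DefsL4

/-!
# Route `KLProgramme` — ENGINE child gen 8 (stmt-HubbardSuperconductivity-20437 `KLRegimeEngineV17F2`), SKELETON v2 class #3, PROVING side: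
# the `∃ (C,u)` with GAP L2 PLUGGED IN BY NAME — soft-line data from k3c2-p2's `gram_klE5SoftLine_bgmFat_sharp_klEng` under the dressing smallness
# (cell gate-hubbard-kl, seat p5 g9; sequel to `…E5WitnessStep`; assembly part 4)

`…E5WitnessStep` §5 derives the class-#3 `∃ (C,u), IsE5Pkg2 (C,u) ∧ E5ShareStep2 P R C u` from RAW step data.  Of its three line/vertex inputs the
SOFT-LINE data (`δ`, `κ₁`) are already a theorem of the tree: `gram_klE5SoftLine_bgmFat_sharp_klEng` (p554106) gives, under EXACTLY the stub binders
(doors `klEngC₃3 ≥ klEngC₃6`, `klEngU₀4 ≥ klEngU₀10`, `klEngL₃ ≤ klEngL₄`, `FrameOK`) and the dressing smallness `‖s_{Λ_n}·κ‖, ‖s_Λ·κ‖ ≤ ½` at every label,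
entries `δ = 8·Cκ·e₀·8^{−(n−2)}` and Gram half-norms `κ₁ = √δ` on the fat family of level `n−2`, for ONE absolute constant `Cκ > 0` (existential).
This file performs that substitution:

* §6 **`exists_e5Pkg2_of_stepDataL1`** (`P.WF`, `R.WF2`, `0 ≤ Cα`, `0 ≤ CA`): if FOR EVERY candidate constant `Cκ > 0` the remaining suppliers provide a
  coupling threshold `u` and, under the binders of `E5ShareStep2 P R · u`, for every step `n ≥ 3` the line-`0` data (`α`, `κ₀` of the RESCALED dressed
  slice derivative), the DRESSING SMALLNESS, the (R1′) carrier's level norms `Nf`/`Ne` w.r.t. the point-augmented thin family, and ONE envelope whose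
  Gram base is `κ₀² + 8·Cκ·e₀·8^{−(n−2)}` (`x′ ≤ ½`; this is where `u` must depend on `Cκ`), with the sizes `α ≤ λ·Cα·ε⁻¹·16^n/e₀²`,
  `A ≤ CA·ε²·(Klam U)³·8^n`; and (`h12`) for the first steps `n ≤ 2` some threshold and the trivial-family raw data of `…E5WitnessStep` — then
  `∃ e, IsE5Pkg2 e ∧ E5ShareStep2 P R e.1 e.2` (share `(4!·13⁴·1680·2⁹·88²·3·(16·Cα)·(max (512·Cκ) Cδ)²·CA)·e₀`, threshold the `min` of the two);
  **`e5ShareStep2_klE5Raise2_of_stepDataL1`** — hence the step for the deferred pair `(klE5Raise2, klE5ShareU2)`.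

What remains INPUT after this file, by name: L1 (`α`, `κ₀` — `…E5WitnessSlice` §3a rescales unscaled data), the dressing smallness (two-leg data of
`𝒱_{n−1}[K_n]`: `κ = klE5Kappa`), the carrier's level norms + envelope + `A`-size (MIXED rows propagated along the slice), and the `n ≤ 2` trivial-family
data.  Pure composition; no definitions, no named facts, nothing about the model's sizes is asserted; nothing asserts superconductivity.
-/

noncomputable section

namespace Summit.HubbardSuperconductivity.HubbardSuperconductivity.Theorems.KLRegimeSplit

set_option linter.dupNamespace false -- summit = problem name (single-conjunct summit), D-0017

open Real Finset Literature.MathematicalPhysics.QuantumLattice Literature.Probability.LatticeModels GrassmannAlgebra Matrix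
open Literature.MathematicalPhysics.QuantumLattice.FermiRG
open Summit.HubbardSuperconductivity.HubbardSuperconductivity.Theorems.KLProgrammeLegKernels
open Summit.HubbardSuperconductivity.HubbardSuperconductivity.Theorems.KLRegimeWick
open Summit.HubbardSuperconductivity.HubbardSuperconductivity.Theorems.EngineV8
open Summit.HubbardSuperconductivity.HubbardSuperconductivity.Theorems.TwoPointAssembly
open Summit.HubbardSuperconductivity.HubbardSuperconductivity.Theorems.TorusFourierL2
open Summit.HubbardSuperconductivity.HubbardSuperconductivity.Theorems.DispersionFlow

/-! ## §6 GAP L2 plugged in by name -/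

section L1

variable (P : SplitConsts) (R : RenConsts) {Cα Cδ CA : ℝ}

/-- **The class-#3 `∃ (C,u)` with the soft-line data DISCHARGED by `gram_klE5SoftLine_bgmFat_sharp_klEng`.**  Remaining inputs: for every `Cκ > 0` a
threshold and, per step `n ≥ 3`, the scaled line-`0` data, the dressing smallness, the (R1′) carrier's level norms, one envelope with Gram base
`κ₀² + 8·Cκ·e₀·8^{−(n−2)}`, the `α`- and `A`-sizes; for `n ≤ 2` a threshold and the trivial-family raw data. [cite: BenfattoGiulianiMastropietro2006, §2.8 (2.80)] -/
theorem exists_e5Pkg2_of_stepDataL1 (hP : P.WF) (hR : R.WF2) (hCα : 0 ≤ Cα) (hCA : 0 ≤ CA)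
    (h3 : ∀ Cκ : ℝ, 0 < Cκ → ∃ u : EngConsts → ℝ → ℝ, (∀ Q cc, 0 < u Q cc) ∧
        ∀ G : GeoConsts, G.WF → ∀ Q : EngConsts, (klEngQ7 P R).IsRaiseOf Q →
        ∀ cc : ℝ, 0 < cc → cc ≤ klEngC₃6 P R →
        ∀ μ ∈ klWindowC, ∀ U : ℝ, 0 < U → U ≤ klEngU₀10 P R cc → U ≤ u Q cc →
        ∀ β : ℝ, klBetaMin ≤ β → β ≤ Real.exp (cc / U ^ 2) →
        ∀ (L M : ℕ) [NeZero L] [NeZero M], klEngL₄ P R β U ≤ L → klEngM₃ β U L ≤ M →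
        ∀ n : ℕ, 1 ≤ n → n ≤ nScales β + 1 → IsKLRegime U cc (-(n : ℤ)) →
        HistP klPredsV17F2 L M G P Q R β U μ 0 n →
        FrameOK R U (nScales β) μ (klFlowFrameU L M β U μ n) →
        (∀ j ≤ n, LevelsUExportMixedAt L M (klCU2 P R (klEngQ7 P R)) P β U μ j) →
        ∀ Λ ∈ Set.Icc (klScale klE0 n) (klScale klE0 (n - 1)), ∀ Qm : TorusSite 2 L,
        ∀ x y : TorusSite 2 L × MatsubaraIdx M, x.1 ∈ klBall L μ 0 → y.1 ∈ klBall L μ 0 →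
        3 ≤ n →
        ∃ (α κ₀ x' A : ℝ) (Nf Ne : ℕ → ℕ → ℝ), 0 ≤ α ∧ 0 ≤ κ₀ ∧
          (∀ X, ∑ Y, ‖((sectorSubMatrix L M β (bgmFatMultiplier L M klE0 β (nambuXiCT L μ (klFlowFrameU L M β U μ n)) (n - 2))).transpose *
            normalCovariance L M (fun ks => ((klScale klE0 (n - 1) - klScale klE0 n : ℝ) : ℂ) * klE5DerivLineSym L M β μ (klFlowFrameU L M β U μ n) (n - 1) (klE5Kappa L M β U μ (klFlowFrameU L M β U μ n) (n - 1)) Λ ks) *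
            sectorSubMatrix L M β (bgmFatMultiplier L M klE0 β (nambuXiCT L μ (klFlowFrameU L M β U μ n)) (n - 2))) X Y‖ ≤ α) ∧
          (∀ Y, ∑ X, ‖((sectorSubMatrix L M β (bgmFatMultiplier L M klE0 β (nambuXiCT L μ (klFlowFrameU L M β U μ n)) (n - 2))).transpose *
            normalCovariance L M (fun ks => ((klScale klE0 (n - 1) - klScale klE0 n : ℝ) : ℂ) * klE5DerivLineSym L M β μ (klFlowFrameU L M β U μ n) (n - 1) (klE5Kappa L M β U μ (klFlowFrameU L M β U μ n) (n - 1)) Λ ks) *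
            sectorSubMatrix L M β (bgmFatMultiplier L M klE0 β (nambuXiCT L μ (klFlowFrameU L M β U μ n)) (n - 2))) X Y‖ ≤ α) ∧
          (∀ Y : SpaceTimeIdx L M × SectorLeg (sectorCount (n - 2)), Y.2.2 = 0 →
            ‖sectorGramF L M β (bgmFatMultiplier L M klE0 β (nambuXiCT L μ (klFlowFrameU L M β U μ n)) (n - 2)) (fun ks => ((klScale klE0 (n - 1) - klScale klE0 n : ℝ) : ℂ) * klE5DerivLineSym L M β μ (klFlowFrameU L M β U μ n) (n - 1) (klE5Kappa L M β U μ (klFlowFrameU L M β U μ n) (n - 1)) Λ ks) Y‖ ≤ κ₀) ∧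
          (∀ Y : SpaceTimeIdx L M × SectorLeg (sectorCount (n - 2)), Y.2.2 = 1 →
            ‖sectorGramG L M β (bgmFatMultiplier L M klE0 β (nambuXiCT L μ (klFlowFrameU L M β U μ n)) (n - 2)) (fun ks => ((klScale klE0 (n - 1) - klScale klE0 n : ℝ) : ℂ) * klE5DerivLineSym L M β μ (klFlowFrameU L M β U μ n) (n - 1) (klE5Kappa L M β U μ (klFlowFrameU L M β U μ n) (n - 1)) Λ ks) Y‖ ≤ κ₀) ∧
          (∀ ks : FreqMomentum L M × Fin 2, ‖klE5SliceSym L M β μ (klFlowFrameU L M β U μ n) (n - 1) (klScale klE0 n) ks * (klE5Kappa L M β U μ (klFlowFrameU L M β U μ n) (n - 1)) ks‖ ≤ 1 / 2 ∧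
            ‖klE5SliceSym L M β μ (klFlowFrameU L M β U μ n) (n - 1) Λ ks * (klE5Kappa L M β U μ (klFlowFrameU L M β U μ n) (n - 1)) ks‖ ≤ 1 / 2) ∧
          (∀ k q, 0 ≤ Ne k q) ∧
          (∀ k ∈ Icc 3 (Fintype.card (HubbardFieldIdx L M × Fin 2) + 2), ∀ q ≤ 4, ∀ σ : Fin q → SectorLeg (sectorCount (n - 2) + 4),
            hubbardSectorKernelNorm L M β (pointAugment (klAnisoFamily L M β μ (klFlowFrameU L M β U μ n) klE0 (n - 2)) (klE5ExtMomenta Qm x y)) (prescribedTuples univ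
              (Fin.append (fun _ : Fin k => (none : Option (SectorLeg (sectorCount (n - 2) + 4)))) (fun j => some (σ j)))) (klE5Carrier L M β μ (klFlowFrameU L M β U μ n) (n - 1) (klE5Kappa L M β U μ (klFlowFrameU L M β U μ n) (n - 1)) (klE5Input L M β U μ (klFlowFrameU L M β U μ n) (n - 1)) Λ) ≤ Nf k q) ∧
          (∀ k ∈ Icc 3 (Fintype.card (HubbardFieldIdx L M × Fin 2) + 2), ∀ q ≤ 4, ∀ (τ : Fin 3 → SectorLeg (sectorCount (n - 2) + 4)) (σ : Fin q → SectorLeg (sectorCount (n - 2) + 4)),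
            hubbardSectorKernelNorm L M β (pointAugment (klAnisoFamily L M β μ (klFlowFrameU L M β U μ n) klE0 (n - 2)) (klE5ExtMomenta Qm x y)) (prescribedTuples univ
              (Fin.append (fun i : Fin k => if h : (i : ℕ) < 3 then some (τ ⟨i, h⟩) else none) (fun j => some (σ j))))
              (klE5Carrier L M β μ (klFlowFrameU L M β U μ n) (n - 1) (klE5Kappa L M β U μ (klFlowFrameU L M β U μ n) (n - 1)) (klE5Input L M β U μ (klFlowFrameU L M β U μ n) (n - 1)) Λ) ≤ Ne k q) ∧
          0 ≤ x' ∧ x' ≤ 1 / 2 ∧ 0 ≤ A ∧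
          (∀ q ∈ Icc 1 4, ∀ k ∈ Icc 3 (Fintype.card (HubbardFieldIdx L M × Fin 2) + 2),
            (κ₀ ^ 2 + 8 * Cκ * (klE0 * ((8 : ℝ) ^ (n - 2))⁻¹)) ^ (k - 3) * ((imagTimeWeight β M * Nf k q) * (imagTimeWeight β M * Ne k (4 - q))) ≤
              x' ^ (k - 3) * A) ∧
          α ≤ (klScale klE0 (n - 1) - klScale klE0 n) * (Cα * (imagTimeWeight β M)⁻¹ * (16 : ℝ) ^ n / klE0 ^ 2) ∧
          A ≤ CA * imagTimeWeight β M ^ 2 * (P.Klam * U) ^ 3 * (8 : ℝ) ^ n)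
    (h12 : ∃ u : EngConsts → ℝ → ℝ, (∀ Q cc, 0 < u Q cc) ∧
        ∀ G : GeoConsts, G.WF → ∀ Q : EngConsts, (klEngQ7 P R).IsRaiseOf Q →
        ∀ cc : ℝ, 0 < cc → cc ≤ klEngC₃6 P R →
        ∀ μ ∈ klWindowC, ∀ U : ℝ, 0 < U → U ≤ klEngU₀10 P R cc → U ≤ u Q cc →
        ∀ β : ℝ, klBetaMin ≤ β → β ≤ Real.exp (cc / U ^ 2) →
        ∀ (L M : ℕ) [NeZero L] [NeZero M], klEngL₄ P R β U ≤ L → klEngM₃ β U L ≤ M →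
        ∀ n : ℕ, 1 ≤ n → n ≤ nScales β + 1 → IsKLRegime U cc (-(n : ℤ)) →
        HistP klPredsV17F2 L M G P Q R β U μ 0 n →
        FrameOK R U (nScales β) μ (klFlowFrameU L M β U μ n) →
        (∀ j ≤ n, LevelsUExportMixedAt L M (klCU2 P R (klEngQ7 P R)) P β U μ j) →
        ∀ Λ ∈ Set.Icc (klScale klE0 n) (klScale klE0 (n - 1)), ∀ Qm : TorusSite 2 L,
        ∀ x y : TorusSite 2 L × MatsubaraIdx M, x.1 ∈ klBall L μ 0 → y.1 ∈ klBall L μ 0 →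
        n ≤ 2 →
        ∃ (α κ₀ δ κ₁ x' A : ℝ) (Nf Ne : ℕ → ℕ → ℝ), 0 ≤ α ∧ 0 ≤ κ₀ ∧ 0 ≤ δ ∧ 0 ≤ κ₁ ∧
          (∀ X, ∑ Y, ‖((sectorSubMatrix L M β (trivialMultiplier L M)).transpose *
            normalCovariance L M (fun ks => ((klScale klE0 (n - 1) - klScale klE0 n : ℝ) : ℂ) * klE5DerivLineSym L M β μ (klFlowFrameU L M β U μ n) (n - 1) (klE5Kappa L M β U μ (klFlowFrameU L M β U μ n) (n - 1)) Λ ks) *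
            sectorSubMatrix L M β (trivialMultiplier L M)) X Y‖ ≤ α) ∧
          (∀ Y, ∑ X, ‖((sectorSubMatrix L M β (trivialMultiplier L M)).transpose *
            normalCovariance L M (fun ks => ((klScale klE0 (n - 1) - klScale klE0 n : ℝ) : ℂ) * klE5DerivLineSym L M β μ (klFlowFrameU L M β U μ n) (n - 1) (klE5Kappa L M β U μ (klFlowFrameU L M β U μ n) (n - 1)) Λ ks) *
            sectorSubMatrix L M β (trivialMultiplier L M)) X Y‖ ≤ α) ∧
          (∀ Y : SpaceTimeIdx L M × SectorLeg 1, Y.2.2 = 0 →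
            ‖sectorGramF L M β (trivialMultiplier L M) (fun ks => ((klScale klE0 (n - 1) - klScale klE0 n : ℝ) : ℂ) * klE5DerivLineSym L M β μ (klFlowFrameU L M β U μ n) (n - 1) (klE5Kappa L M β U μ (klFlowFrameU L M β U μ n) (n - 1)) Λ ks) Y‖ ≤ κ₀) ∧
          (∀ Y : SpaceTimeIdx L M × SectorLeg 1, Y.2.2 = 1 →
            ‖sectorGramG L M β (trivialMultiplier L M) (fun ks => ((klScale klE0 (n - 1) - klScale klE0 n : ℝ) : ℂ) * klE5DerivLineSym L M β μ (klFlowFrameU L M β U μ n) (n - 1) (klE5Kappa L M β U μ (klFlowFrameU L M β U μ n) (n - 1)) Λ ks) Y‖ ≤ κ₀) ∧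
          (∀ X Y, ‖((sectorSubMatrix L M β (trivialMultiplier L M)).transpose * normalCovariance L M (klE5SoftLineSym L M β μ (klFlowFrameU L M β U μ n) (n - 1) (klE5Kappa L M β U μ (klFlowFrameU L M β U μ n) (n - 1)) Λ) *
            sectorSubMatrix L M β (trivialMultiplier L M)) X Y‖ ≤ δ) ∧
          (∀ Y : SpaceTimeIdx L M × SectorLeg 1, Y.2.2 = 0 → ‖sectorGramF L M β (trivialMultiplier L M) (klE5SoftLineSym L M β μ (klFlowFrameU L M β U μ n) (n - 1) (klE5Kappa L M β U μ (klFlowFrameU L M β U μ n) (n - 1)) Λ) Y‖ ≤ κ₁) ∧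
          (∀ Y : SpaceTimeIdx L M × SectorLeg 1, Y.2.2 = 1 → ‖sectorGramG L M β (trivialMultiplier L M) (klE5SoftLineSym L M β μ (klFlowFrameU L M β U μ n) (n - 1) (klE5Kappa L M β U μ (klFlowFrameU L M β U μ n) (n - 1)) Λ) Y‖ ≤ κ₁) ∧
          (∀ k q, 0 ≤ Ne k q) ∧
          (∀ k ∈ Icc 3 (Fintype.card (HubbardFieldIdx L M × Fin 2) + 2), ∀ q ≤ 4, ∀ σ : Fin q → SectorLeg 1,
            hubbardSectorKernelNorm L M β (trivialMultiplier L M) (prescribedTuples univ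
              (Fin.append (fun _ : Fin k => (none : Option (SectorLeg 1))) (fun j => some (σ j)))) (klE5Carrier L M β μ (klFlowFrameU L M β U μ n) (n - 1) (klE5Kappa L M β U μ (klFlowFrameU L M β U μ n) (n - 1)) (klE5Input L M β U μ (klFlowFrameU L M β U μ n) (n - 1)) Λ) ≤ Nf k q) ∧
          (∀ k ∈ Icc 3 (Fintype.card (HubbardFieldIdx L M × Fin 2) + 2), ∀ q ≤ 4, ∀ (τ : Fin 3 → SectorLeg 1) (σ : Fin q → SectorLeg 1),
            hubbardSectorKernelNorm L M β (trivialMultiplier L M) (prescribedTuples univ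
              (Fin.append (fun i : Fin k => if h : (i : ℕ) < 3 then some (τ ⟨i, h⟩) else none) (fun j => some (σ j))))
              (klE5Carrier L M β μ (klFlowFrameU L M β U μ n) (n - 1) (klE5Kappa L M β U μ (klFlowFrameU L M β U μ n) (n - 1)) (klE5Input L M β U μ (klFlowFrameU L M β U μ n) (n - 1)) Λ) ≤ Ne k q) ∧
          0 ≤ x' ∧ x' ≤ 1 / 2 ∧ 0 ≤ A ∧
          (∀ q ∈ Icc 1 4, ∀ k ∈ Icc 3 (Fintype.card (HubbardFieldIdx L M × Fin 2) + 2),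
            (κ₀ ^ 2 + κ₁ ^ 2) ^ (k - 3) * ((imagTimeWeight β M * Nf k q) * (imagTimeWeight β M * Ne k (4 - q))) ≤ x' ^ (k - 3) * A) ∧
          α ≤ (klScale klE0 (n - 1) - klScale klE0 n) * (Cα * (imagTimeWeight β M)⁻¹ * (16 : ℝ) ^ n / klE0 ^ 2) ∧
          δ ≤ Cδ * klE0 * ((8 : ℝ) ^ n)⁻¹ ∧ A ≤ CA * imagTimeWeight β M ^ 2 * (P.Klam * U) ^ 3 * (8 : ℝ) ^ n) :
    ∃ e : ℝ × (EngConsts → ℝ → ℝ), IsE5Pkg2 e ∧ E5ShareStep2 P R e.1 e.2 := by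
  obtain ⟨Cκ, hCκ, hL2⟩ := gram_klE5SoftLine_bgmFat_sharp_klEng
  obtain ⟨u3, hu3, h3⟩ := h3 Cκ hCκ
  obtain ⟨u12, hu12, h12⟩ := h12
  have he₀ : (0 : ℝ) < klE0 := by norm_num [klE0]
  refine exists_e5Pkg2_of_stepData P R (Cα := Cα) (Cδ := max (512 * Cκ) Cδ) (CA := CA) (u := fun Q cc => min (u3 Q cc) (u12 Q cc)) hCα hCA
    (fun Q cc => lt_min (hu3 Q cc) (hu12 Q cc)) ?_ ?_
  · intro G hG Q hQ cc hcc hcc3 μ hμ U hU hU10 hUu β hβ hβc L M _ _ hL hM n hn hnN hreg hH hF hX Λ hΛ Qm x y hx hy h3n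
    obtain ⟨α, κ₀, x', A, Nf, Ne, hα, hκ₀, hrow, hcol, hκF₀, hκG₀, hsmall, hNe0, hNf, hNe, hx0, hx1, hA, henv, hαs, hAs⟩ :=
      h3 G hG Q hQ cc hcc hcc3 μ hμ U hU hU10 (hUu.trans (min_le_left _ _)) β hβ hβc L M hL hM n hn hnN hreg hH hF hX Λ hΛ Qm x y hx hy h3n
    have hsmall' : ∀ ks : FreqMomentum L M × Fin 2,
        ‖klE5SliceSym L M β μ (klFlowFrameU L M β U μ n) (n - 1) (klScale klE0 (n - 1 + 1)) ks * klE5Kappa L M β U μ (klFlowFrameU L M β U μ n) (n - 1) ks‖ ≤ 1 / 2 ∧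
        ‖klE5SliceSym L M β μ (klFlowFrameU L M β U μ n) (n - 1) Λ ks * klE5Kappa L M β U μ (klFlowFrameU L M β U μ n) (n - 1) ks‖ ≤ 1 / 2 := by
      rw [Nat.sub_add_cancel hn]; exact hsmall
    obtain ⟨hent, -, hκF₁, hκG₁⟩ := hL2 P R cc hP hR hcc (hcc3.trans (klEngC₃6_le_klEngC₃3 P R)) μ hμ U hU (hU10.trans (klEngU₀10_le_klEngU₀4 P R cc))
      β hβ hβc (klFlowFrameU L M β U μ n) hF L M ((klEngL₃_le_klEngL₄ P R β U).trans hL) hM (n - 2) (by omega) (by omega) (n - 1)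
      (klE5Kappa L M β U μ (klFlowFrameU L M β U μ n) (n - 1)) Λ hsmall'
    have hδ0 : (0 : ℝ) ≤ 8 * Cκ * (klE0 * ((8 : ℝ) ^ (n - 2))⁻¹) := by positivity
    refine ⟨α, κ₀, 8 * Cκ * (klE0 * ((8 : ℝ) ^ (n - 2))⁻¹), Real.sqrt (8 * Cκ * (klE0 * ((8 : ℝ) ^ (n - 2))⁻¹)), x', A, Nf, Ne, hα, hκ₀, hδ0,
      Real.sqrt_nonneg _, hrow, hcol, hκF₀, hκG₀, hent, fun Y _ => hκF₁ Y, fun Y _ => hκG₁ Y, hNe0, hNf, hNe, hx0, hx1, hA, ?_, hαs, ?_, hAs⟩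
    · intro q hq k hk
      rw [Real.sq_sqrt hδ0]
      exact henv q hq k hk
    · -- `8·Cκ·e₀·8^{−(n−2)} = 512·Cκ·e₀·8^{−n} ≤ max(512·Cκ, Cδ)·e₀·8^{−n}`
      have h8 : ((8 : ℝ) ^ (n - 2))⁻¹ = 64 * ((8 : ℝ) ^ n)⁻¹ := by
        have e : (8 : ℝ) ^ n = (8 : ℝ) ^ (n - 2) * 64 := by
          rw [show (64 : ℝ) = 8 ^ 2 by norm_num, ← pow_add, Nat.sub_add_cancel (by omega : 2 ≤ n)]
        have h0 : (8 : ℝ) ^ (n - 2) ≠ 0 := pow_ne_zero _ (by norm_num)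
        rw [e, mul_inv]
        field_simp
      rw [h8]
      have h1 : 8 * Cκ * (klE0 * (64 * ((8 : ℝ) ^ n)⁻¹)) = (512 * Cκ) * klE0 * ((8 : ℝ) ^ n)⁻¹ := by ring
      rw [h1]
      exact mul_le_mul_of_nonneg_right (mul_le_mul_of_nonneg_right (le_max_left _ _) he₀.le) (by positivity)
  · intro G hG Q hQ cc hcc hcc3 μ hμ U hU hU10 hUu β hβ hβc L M _ _ hL hM n hn hnN hreg hH hF hX Λ hΛ Qm x y hx hy h12n
    obtain ⟨α, κ₀, δ, κ₁, x', A, Nf, Ne, hα, hκ₀, hδ, hκ₁, hrow, hcol, hκF₀, hκG₀, hent, hκF₁, hκG₁, hNe0, hNf, hNe, hx0, hx1, hA, henv, hαs, hδs, hAs⟩ :=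
      h12 G hG Q hQ cc hcc hcc3 μ hμ U hU hU10 (hUu.trans (min_le_right _ _)) β hβ hβc L M hL hM n hn hnN hreg hH hF hX Λ hΛ Qm x y hx hy h12n
    refine ⟨α, κ₀, δ, κ₁, x', A, Nf, Ne, hα, hκ₀, hδ, hκ₁, hrow, hcol, hκF₀, hκG₀, hent, hκF₁, hκG₁, hNe0, hNf, hNe, hx0, hx1, hA, henv, hαs,
      hδs.trans ?_, hAs⟩
    exact mul_le_mul_of_nonneg_right (mul_le_mul_of_nonneg_right (le_max_right _ _) he₀.le) (by positivity)

/-- **Hence the successor step for the DEFERRED pair** `(klE5Raise2 P R, klE5ShareU2 P R)` with GAP L2 plugged in by name.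
[cite: BenfattoGiulianiMastropietro2006, §2.8 (2.80)] -/
theorem e5ShareStep2_klE5Raise2_of_stepDataL1 (hP : P.WF) (hR : R.WF2) (hCα : 0 ≤ Cα) (hCA : 0 ≤ CA)
    (h3 : ∀ Cκ : ℝ, 0 < Cκ → ∃ u : EngConsts → ℝ → ℝ, (∀ Q cc, 0 < u Q cc) ∧
        ∀ G : GeoConsts, G.WF → ∀ Q : EngConsts, (klEngQ7 P R).IsRaiseOf Q →
        ∀ cc : ℝ, 0 < cc → cc ≤ klEngC₃6 P R →
        ∀ μ ∈ klWindowC, ∀ U : ℝ, 0 < U → U ≤ klEngU₀10 P R cc → U ≤ u Q cc →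
        ∀ β : ℝ, klBetaMin ≤ β → β ≤ Real.exp (cc / U ^ 2) →
        ∀ (L M : ℕ) [NeZero L] [NeZero M], klEngL₄ P R β U ≤ L → klEngM₃ β U L ≤ M →
        ∀ n : ℕ, 1 ≤ n → n ≤ nScales β + 1 → IsKLRegime U cc (-(n : ℤ)) →
        HistP klPredsV17F2 L M G P Q R β U μ 0 n →
        FrameOK R U (nScales β) μ (klFlowFrameU L M β U μ n) →
        (∀ j ≤ n, LevelsUExportMixedAt L M (klCU2 P R (klEngQ7 P R)) P β U μ j) →
        ∀ Λ ∈ Set.Icc (klScale klE0 n) (klScale klE0 (n - 1)), ∀ Qm : TorusSite 2 L,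
        ∀ x y : TorusSite 2 L × MatsubaraIdx M, x.1 ∈ klBall L μ 0 → y.1 ∈ klBall L μ 0 →
        3 ≤ n →
        ∃ (α κ₀ x' A : ℝ) (Nf Ne : ℕ → ℕ → ℝ), 0 ≤ α ∧ 0 ≤ κ₀ ∧
          (∀ X, ∑ Y, ‖((sectorSubMatrix L M β (bgmFatMultiplier L M klE0 β (nambuXiCT L μ (klFlowFrameU L M β U μ n)) (n - 2))).transpose *
            normalCovariance L M (fun ks => ((klScale klE0 (n - 1) - klScale klE0 n : ℝ) : ℂ) * klE5DerivLineSym L M β μ (klFlowFrameU L M β U μ n) (n - 1) (klE5Kappa L M β U μ (klFlowFrameU L M β U μ n) (n - 1)) Λ ks) *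
            sectorSubMatrix L M β (bgmFatMultiplier L M klE0 β (nambuXiCT L μ (klFlowFrameU L M β U μ n)) (n - 2))) X Y‖ ≤ α) ∧
          (∀ Y, ∑ X, ‖((sectorSubMatrix L M β (bgmFatMultiplier L M klE0 β (nambuXiCT L μ (klFlowFrameU L M β U μ n)) (n - 2))).transpose *
            normalCovariance L M (fun ks => ((klScale klE0 (n - 1) - klScale klE0 n : ℝ) : ℂ) * klE5DerivLineSym L M β μ (klFlowFrameU L M β U μ n) (n - 1) (klE5Kappa L M β U μ (klFlowFrameU L M β U μ n) (n - 1)) Λ ks) *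
            sectorSubMatrix L M β (bgmFatMultiplier L M klE0 β (nambuXiCT L μ (klFlowFrameU L M β U μ n)) (n - 2))) X Y‖ ≤ α) ∧
          (∀ Y : SpaceTimeIdx L M × SectorLeg (sectorCount (n - 2)), Y.2.2 = 0 →
            ‖sectorGramF L M β (bgmFatMultiplier L M klE0 β (nambuXiCT L μ (klFlowFrameU L M β U μ n)) (n - 2)) (fun ks => ((klScale klE0 (n - 1) - klScale klE0 n : ℝ) : ℂ) * klE5DerivLineSym L M β μ (klFlowFrameU L M β U μ n) (n - 1) (klE5Kappa L M β U μ (klFlowFrameU L M β U μ n) (n - 1)) Λ ks) Y‖ ≤ κ₀) ∧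
          (∀ Y : SpaceTimeIdx L M × SectorLeg (sectorCount (n - 2)), Y.2.2 = 1 →
            ‖sectorGramG L M β (bgmFatMultiplier L M klE0 β (nambuXiCT L μ (klFlowFrameU L M β U μ n)) (n - 2)) (fun ks => ((klScale klE0 (n - 1) - klScale klE0 n : ℝ) : ℂ) * klE5DerivLineSym L M β μ (klFlowFrameU L M β U μ n) (n - 1) (klE5Kappa L M β U μ (klFlowFrameU L M β U μ n) (n - 1)) Λ ks) Y‖ ≤ κ₀) ∧
          (∀ ks : FreqMomentum L M × Fin 2, ‖klE5SliceSym L M β μ (klFlowFrameU L M β U μ n) (n - 1) (klScale klE0 n) ks * (klE5Kappa L M β U μ (klFlowFrameU L M β U μ n) (n - 1)) ks‖ ≤ 1 / 2 ∧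
            ‖klE5SliceSym L M β μ (klFlowFrameU L M β U μ n) (n - 1) Λ ks * (klE5Kappa L M β U μ (klFlowFrameU L M β U μ n) (n - 1)) ks‖ ≤ 1 / 2) ∧
          (∀ k q, 0 ≤ Ne k q) ∧
          (∀ k ∈ Icc 3 (Fintype.card (HubbardFieldIdx L M × Fin 2) + 2), ∀ q ≤ 4, ∀ σ : Fin q → SectorLeg (sectorCount (n - 2) + 4),
            hubbardSectorKernelNorm L M β (pointAugment (klAnisoFamily L M β μ (klFlowFrameU L M β U μ n) klE0 (n - 2)) (klE5ExtMomenta Qm x y)) (prescribedTuples univ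
              (Fin.append (fun _ : Fin k => (none : Option (SectorLeg (sectorCount (n - 2) + 4)))) (fun j => some (σ j)))) (klE5Carrier L M β μ (klFlowFrameU L M β U μ n) (n - 1) (klE5Kappa L M β U μ (klFlowFrameU L M β U μ n) (n - 1)) (klE5Input L M β U μ (klFlowFrameU L M β U μ n) (n - 1)) Λ) ≤ Nf k q) ∧
          (∀ k ∈ Icc 3 (Fintype.card (HubbardFieldIdx L M × Fin 2) + 2), ∀ q ≤ 4, ∀ (τ : Fin 3 → SectorLeg (sectorCount (n - 2) + 4)) (σ : Fin q → SectorLeg (sectorCount (n - 2) + 4)),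
            hubbardSectorKernelNorm L M β (pointAugment (klAnisoFamily L M β μ (klFlowFrameU L M β U μ n) klE0 (n - 2)) (klE5ExtMomenta Qm x y)) (prescribedTuples univ
              (Fin.append (fun i : Fin k => if h : (i : ℕ) < 3 then some (τ ⟨i, h⟩) else none) (fun j => some (σ j))))
              (klE5Carrier L M β μ (klFlowFrameU L M β U μ n) (n - 1) (klE5Kappa L M β U μ (klFlowFrameU L M β U μ n) (n - 1)) (klE5Input L M β U μ (klFlowFrameU L M β U μ n) (n - 1)) Λ) ≤ Ne k q) ∧
          0 ≤ x' ∧ x' ≤ 1 / 2 ∧ 0 ≤ A ∧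
          (∀ q ∈ Icc 1 4, ∀ k ∈ Icc 3 (Fintype.card (HubbardFieldIdx L M × Fin 2) + 2),
            (κ₀ ^ 2 + 8 * Cκ * (klE0 * ((8 : ℝ) ^ (n - 2))⁻¹)) ^ (k - 3) * ((imagTimeWeight β M * Nf k q) * (imagTimeWeight β M * Ne k (4 - q))) ≤
              x' ^ (k - 3) * A) ∧
          α ≤ (klScale klE0 (n - 1) - klScale klE0 n) * (Cα * (imagTimeWeight β M)⁻¹ * (16 : ℝ) ^ n / klE0 ^ 2) ∧
          A ≤ CA * imagTimeWeight β M ^ 2 * (P.Klam * U) ^ 3 * (8 : ℝ) ^ n)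
    (h12 : ∃ u : EngConsts → ℝ → ℝ, (∀ Q cc, 0 < u Q cc) ∧
        ∀ G : GeoConsts, G.WF → ∀ Q : EngConsts, (klEngQ7 P R).IsRaiseOf Q →
        ∀ cc : ℝ, 0 < cc → cc ≤ klEngC₃6 P R →
        ∀ μ ∈ klWindowC, ∀ U : ℝ, 0 < U → U ≤ klEngU₀10 P R cc → U ≤ u Q cc →
        ∀ β : ℝ, klBetaMin ≤ β → β ≤ Real.exp (cc / U ^ 2) →
        ∀ (L M : ℕ) [NeZero L] [NeZero M], klEngL₄ P R β U ≤ L → klEngM₃ β U L ≤ M →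
        ∀ n : ℕ, 1 ≤ n → n ≤ nScales β + 1 → IsKLRegime U cc (-(n : ℤ)) →
        HistP klPredsV17F2 L M G P Q R β U μ 0 n →
        FrameOK R U (nScales β) μ (klFlowFrameU L M β U μ n) →
        (∀ j ≤ n, LevelsUExportMixedAt L M (klCU2 P R (klEngQ7 P R)) P β U μ j) →
        ∀ Λ ∈ Set.Icc (klScale klE0 n) (klScale klE0 (n - 1)), ∀ Qm : TorusSite 2 L,
        ∀ x y : TorusSite 2 L × MatsubaraIdx M, x.1 ∈ klBall L μ 0 → y.1 ∈ klBall L μ 0 →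
        n ≤ 2 →
        ∃ (α κ₀ δ κ₁ x' A : ℝ) (Nf Ne : ℕ → ℕ → ℝ), 0 ≤ α ∧ 0 ≤ κ₀ ∧ 0 ≤ δ ∧ 0 ≤ κ₁ ∧
          (∀ X, ∑ Y, ‖((sectorSubMatrix L M β (trivialMultiplier L M)).transpose *
            normalCovariance L M (fun ks => ((klScale klE0 (n - 1) - klScale klE0 n : ℝ) : ℂ) * klE5DerivLineSym L M β μ (klFlowFrameU L M β U μ n) (n - 1) (klE5Kappa L M β U μ (klFlowFrameU L M β U μ n) (n - 1)) Λ ks) *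
            sectorSubMatrix L M β (trivialMultiplier L M)) X Y‖ ≤ α) ∧
          (∀ Y, ∑ X, ‖((sectorSubMatrix L M β (trivialMultiplier L M)).transpose *
            normalCovariance L M (fun ks => ((klScale klE0 (n - 1) - klScale klE0 n : ℝ) : ℂ) * klE5DerivLineSym L M β μ (klFlowFrameU L M β U μ n) (n - 1) (klE5Kappa L M β U μ (klFlowFrameU L M β U μ n) (n - 1)) Λ ks) *
            sectorSubMatrix L M β (trivialMultiplier L M)) X Y‖ ≤ α) ∧
          (∀ Y : SpaceTimeIdx L M × SectorLeg 1, Y.2.2 = 0 →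
            ‖sectorGramF L M β (trivialMultiplier L M) (fun ks => ((klScale klE0 (n - 1) - klScale klE0 n : ℝ) : ℂ) * klE5DerivLineSym L M β μ (klFlowFrameU L M β U μ n) (n - 1) (klE5Kappa L M β U μ (klFlowFrameU L M β U μ n) (n - 1)) Λ ks) Y‖ ≤ κ₀) ∧
          (∀ Y : SpaceTimeIdx L M × SectorLeg 1, Y.2.2 = 1 →
            ‖sectorGramG L M β (trivialMultiplier L M) (fun ks => ((klScale klE0 (n - 1) - klScale klE0 n : ℝ) : ℂ) * klE5DerivLineSym L M β μ (klFlowFrameU L M β U μ n) (n - 1) (klE5Kappa L M β U μ (klFlowFrameU L M β U μ n) (n - 1)) Λ ks) Y‖ ≤ κ₀) ∧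
          (∀ X Y, ‖((sectorSubMatrix L M β (trivialMultiplier L M)).transpose * normalCovariance L M (klE5SoftLineSym L M β μ (klFlowFrameU L M β U μ n) (n - 1) (klE5Kappa L M β U μ (klFlowFrameU L M β U μ n) (n - 1)) Λ) *
            sectorSubMatrix L M β (trivialMultiplier L M)) X Y‖ ≤ δ) ∧
          (∀ Y : SpaceTimeIdx L M × SectorLeg 1, Y.2.2 = 0 → ‖sectorGramF L M β (trivialMultiplier L M) (klE5SoftLineSym L M β μ (klFlowFrameU L M β U μ n) (n - 1) (klE5Kappa L M β U μ (klFlowFrameU L M β U μ n) (n - 1)) Λ) Y‖ ≤ κ₁) ∧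
          (∀ Y : SpaceTimeIdx L M × SectorLeg 1, Y.2.2 = 1 → ‖sectorGramG L M β (trivialMultiplier L M) (klE5SoftLineSym L M β μ (klFlowFrameU L M β U μ n) (n - 1) (klE5Kappa L M β U μ (klFlowFrameU L M β U μ n) (n - 1)) Λ) Y‖ ≤ κ₁) ∧
          (∀ k q, 0 ≤ Ne k q) ∧
          (∀ k ∈ Icc 3 (Fintype.card (HubbardFieldIdx L M × Fin 2) + 2), ∀ q ≤ 4, ∀ σ : Fin q → SectorLeg 1,
            hubbardSectorKernelNorm L M β (trivialMultiplier L M) (prescribedTuples univ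
              (Fin.append (fun _ : Fin k => (none : Option (SectorLeg 1))) (fun j => some (σ j)))) (klE5Carrier L M β μ (klFlowFrameU L M β U μ n) (n - 1) (klE5Kappa L M β U μ (klFlowFrameU L M β U μ n) (n - 1)) (klE5Input L M β U μ (klFlowFrameU L M β U μ n) (n - 1)) Λ) ≤ Nf k q) ∧
          (∀ k ∈ Icc 3 (Fintype.card (HubbardFieldIdx L M × Fin 2) + 2), ∀ q ≤ 4, ∀ (τ : Fin 3 → SectorLeg 1) (σ : Fin q → SectorLeg 1),
            hubbardSectorKernelNorm L M β (trivialMultiplier L M) (prescribedTuples univ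
              (Fin.append (fun i : Fin k => if h : (i : ℕ) < 3 then some (τ ⟨i, h⟩) else none) (fun j => some (σ j))))
              (klE5Carrier L M β μ (klFlowFrameU L M β U μ n) (n - 1) (klE5Kappa L M β U μ (klFlowFrameU L M β U μ n) (n - 1)) (klE5Input L M β U μ (klFlowFrameU L M β U μ n) (n - 1)) Λ) ≤ Ne k q) ∧
          0 ≤ x' ∧ x' ≤ 1 / 2 ∧ 0 ≤ A ∧
          (∀ q ∈ Icc 1 4, ∀ k ∈ Icc 3 (Fintype.card (HubbardFieldIdx L M × Fin 2) + 2),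
            (κ₀ ^ 2 + κ₁ ^ 2) ^ (k - 3) * ((imagTimeWeight β M * Nf k q) * (imagTimeWeight β M * Ne k (4 - q))) ≤ x' ^ (k - 3) * A) ∧
          α ≤ (klScale klE0 (n - 1) - klScale klE0 n) * (Cα * (imagTimeWeight β M)⁻¹ * (16 : ℝ) ^ n / klE0 ^ 2) ∧
          δ ≤ Cδ * klE0 * ((8 : ℝ) ^ n)⁻¹ ∧ A ≤ CA * imagTimeWeight β M ^ 2 * (P.Klam * U) ^ 3 * (8 : ℝ) ^ n) :
    E5ShareStep2 P R (klE5Raise2 P R) (klE5ShareU2 P R) :=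
  e5ShareStep2_klE5Raise2_of_exists (exists_e5Pkg2_of_stepDataL1 P R hP hR hCα hCA h3 h12)

end L1

end Summit.HubbardSuperconductivity.HubbardSuperconductivity.Theorems.KLRegimeSplit

end
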